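import Literature.AlgebraicGeometry.Resolution.SemiGenericFormalFibresPolynomial
import Literature.AlgebraicGeometry.Resolution.AdicQuotient
import HarnessLib

/-!
# Stacks 07PR for polynomial rings, transported to abstract localisations

Topic: `Literature/AlgebraicGeometry/Resolution`. `SemiGenericFormalFibresPolynomial.lean` proves
that `L ⊗_A (A[x]_Q)^` is a regular ring for a complete regular local ring `A`, a prime `Q` of
`A[x]` and a finite extension `L` of `Frac A`, with `A[x]_Q` the concrete `Localization.AtPrime Q`.
Here the same statement is transported to any localisation `S` of `A[x]` at `Q`
(`IsLocalization.AtPrime S Q`) and to any `A`-algebra `T ≅ A[x]` in place of `A[x]` — the form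
in which it is used for the local rings `C_𝔫` of a finite `A[x]_Q`-algebra `C` which is a
localisation of a second polynomial ring `A[y] ⊇ A[x]` (the Frobenius pull-back `x = y^q` in the
proof of Stacks 07PV in characteristic `p`). Everything is PROVED; no new notions, no named
facts.

## Content (namespace `Literature.AlgebraicGeometry.Resolution`)

* `map_maximalIdeal_algEquiv`, `exists_algEquiv_adicCompletion_of_algEquiv` — an `R`-algebra
  isomorphism of local rings induces one of their completions (`adicCompletionCongr`).
* `isRegularRing_tensor_completion_polynomial_of_isLocalization_atPrime` — `L ⊗_A Ŝ` is regular
  for any localisation `S` of `A[x]` at `Q`.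
* `isRegularRing_tensor_completion_of_algEquiv_polynomial` — the same for `T ≅ A[x]`.

## Sources

* The Stacks Project, Tag 07PR (Lemma 15.51.5). [StacksProject]
* H. Matsumura, *Commutative Ring Theory*, CUP 1986, proof of Thm. 32.3, pp. 258–259.
  [Matsumura1987]
-/

noncomputable section

open IsLocalRing TensorProduct Polynomial

namespace Literature.AlgebraicGeometry.Resolution

universe u

/-! ## Completions along algebra isomorphisms of local rings -/

section Congr

variable {R S S₂ : Type u} [CommRing R] [CommRing S] [CommRing S₂] [IsLocalRing S]
  [IsLocalRing S₂] [Algebra R S] [Algebra R S₂]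

/-- A ring isomorphism of local rings maps the maximal ideal onto the maximal ideal. [folklore] -/
theorem map_maximalIdeal_ringEquiv (e : S ≃+* S₂) :
    (maximalIdeal S).map e.toRingHom = maximalIdeal S₂ := by
  apply le_antisymm
  · rw [Ideal.map_le_iff_le_comap]
    intro x hx
    rw [Ideal.mem_comap, mem_maximalIdeal, mem_nonunits_iff]
    rw [mem_maximalIdeal, mem_nonunits_iff] at hx
    exact fun hu => hx (by simpa using hu.map e.symm)
  · intro y hy
    have h1 : e.symm y ∈ maximalIdeal S := by
      rw [mem_maximalIdeal, mem_nonunits_iff] at hy ⊢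
      exact fun hu => hy (by simpa using hu.map e)
    have h2 : y = e.toRingHom (e.symm y) := (e.apply_symm_apply y).symm
    rw [h2]
    exact Ideal.mem_map_of_mem _ h1

/-- **An `R`-algebra isomorphism `S ≃ S₂` of local rings induces an `R`-algebra isomorphism of
their completions** (`adicCompletionCongr`, extended by `R`-linearity on the dense image).
[folklore] -/
theorem exists_algEquiv_adicCompletion_of_algEquiv (e : S ≃ₐ[R] S₂) :
    Nonempty (AdicCompletion (maximalIdeal S) S ≃ₐ[R] AdicCompletion (maximalIdeal S₂) S₂) := by
  let ê := adicCompletionCongr (maximalIdeal S) (maximalIdeal S₂) e.toRingEquiv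
    (map_maximalIdeal_ringEquiv e.toRingEquiv)
  refine ⟨AlgEquiv.ofRingEquiv (f := ê) fun r => ?_⟩
  rw [AdicCompletion.algebraMap_apply, AdicCompletion.algebraMap_apply]
  change adicCompletionCongr _ _ e.toRingEquiv _ (AdicCompletion.of _ S (algebraMap R S r)) = _
  rw [adicCompletionCongr_of]
  change AdicCompletion.of _ S₂ (e (algebraMap R S r)) = _
  rw [AlgEquiv.commutes]

end Congr

/-! ## Stacks 07PR for polynomial rings, abstract localisation -/

section Transport

variable (A : Type u) [CommRing A] [IsRegularLocalRing A] [IsAdicComplete (maximalIdeal A) A]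
  (K : Type u) [Field K] [Algebra A K] [IsFractionRing A K]
  (L : Type u) [Field L] [Algebra K L] [FiniteDimensional K L] [Algebra A L] [IsScalarTower A K L]

include K in
/-- **Stacks 07PR for polynomial rings, for any localisation `S` of `A[x]` at `Q`**: `L ⊗_A Ŝ` is
a regular ring (`isRegularRing_tensor_completion_polynomial`, transported along
`S ≅ A[x]_Q`). [cite: StacksProject, Tag 07PR] -/
theorem isRegularRing_tensor_completion_polynomial_of_isLocalization_atPrime (Q : Ideal A[X])
    [Q.IsPrime] (S : Type u) [CommRing S] [IsLocalRing S] [Algebra A[X] S]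
    [IsLocalization.AtPrime S Q] [Algebra A S] [IsScalarTower A A[X] S] :
    IsRegularRing (L ⊗[A] AdicCompletion (maximalIdeal S) S) := by
  haveI := isRegularRing_tensor_completion_polynomial A Q K L
  let e : S ≃ₐ[A[X]] Localization.AtPrime Q :=
    IsLocalization.algEquiv Q.primeCompl S (Localization.AtPrime Q)
  obtain ⟨ê⟩ := exists_algEquiv_adicCompletion_of_algEquiv (e.restrictScalars A)
  exact IsRegularRing.of_ringEquiv (R := L ⊗[A] CompletionAtPrime A[X] Q)
    (Algebra.TensorProduct.congr (AlgEquiv.refl (R := A) (A₁ := L)) ê.symm).toRingEquiv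

include K in
/-- **Stacks 07PR for polynomial rings, for `T ≅ A[x]` and any localisation `S` of `T` at a
prime `Q`**: `L ⊗_A Ŝ` is a regular ring. [cite: StacksProject, Tag 07PR] -/
theorem isRegularRing_tensor_completion_of_algEquiv_polynomial (T : Type u) [CommRing T]
    [Algebra A T] (eT : T ≃ₐ[A] A[X]) (Q : Ideal T) [Q.IsPrime] (S : Type u) [CommRing S]
    [IsLocalRing S] [Algebra T S] [IsLocalization.AtPrime S Q] [Algebra A S]
    [IsScalarTower A T S] : IsRegularRing (L ⊗[A] AdicCompletion (maximalIdeal S) S) := by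
  -- `S` as an `A[x]`-algebra through `eT⁻¹`
  letI : Algebra A[X] S := ((algebraMap T S).comp eT.toRingEquiv.symm.toRingHom).toAlgebra
  haveI : IsScalarTower A A[X] S := IsScalarTower.of_algebraMap_eq fun a => by
    change algebraMap A S a = algebraMap T S (eT.toRingEquiv.symm (algebraMap A A[X] a))
    rw [IsScalarTower.algebraMap_apply A T S]
    congr 1
    change _ = eT.symm (algebraMap A A[X] a)
    rw [AlgEquiv.commutes]
  haveI : (Q.map (eT : T →+* A[X])).IsPrime := Ideal.map_isPrime_of_equiv eT
  have hloc := IsLocalization.isLocalization_of_base_ringEquiv Q.primeCompl S eT.toRingEquiv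
  have hQ : (Q.map (eT : T →+* A[X])).comap eT.toRingEquiv = Q := by
    change (Q.map (eT : T →+* A[X])).comap (eT : T →+* A[X]) = Q
    exact Ideal.comap_map_of_bijective _ eT.bijective
  have hM : Q.primeCompl.map eT.toRingEquiv = (Q.map (eT : T →+* A[X])).primeCompl := by
    ext x
    constructor
    · rintro ⟨y, hy, rfl⟩ hx
      refine hy ?_
      rw [← hQ, SetLike.mem_coe, Ideal.mem_comap]
      exact hx
    · intro hx
      refine ⟨eT.toRingEquiv.symm x, fun hy => hx ?_, eT.toRingEquiv.apply_symm_apply x⟩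
      rw [← hQ, SetLike.mem_coe, Ideal.mem_comap, RingEquiv.apply_symm_apply] at hy
      exact hy
  haveI : IsLocalization.AtPrime S (Q.map (eT : T →+* A[X])) := by
    change IsLocalization (Q.map (eT : T →+* A[X])).primeCompl S
    rw [← hM]
    exact hloc
  exact isRegularRing_tensor_completion_polynomial_of_isLocalization_atPrime A K L
    (Q.map (eT : T →+* A[X])) S

end Transport

end Literature.AlgebraicGeometry.Resolution

end
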